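import Literature.NumberTheory.EllipticCurves.BSDInvariants
import Literature.NumberTheory.EllipticCurves.RegulatorProofs
import Literature.NumberTheory.EllipticCurves.MordellWeilProofs
import Literature.NumberTheory.EllipticCurves.TamagawaFiniteIndexProofs
import HarnessLib

/-!
# Discharges of named facts of `BSDInvariants.lean`: positivity of the BSD right-hand side

Sibling file of `Literature.NumberTheory.EllipticCurves.BSDInvariants` (D-0014 keeps `Literature/`
sorry-free by stating cited results as named facts `def X : Prop`; a discharge is a
`theorem X_holds : X`). Proved here, for an elliptic curve `W` over `ℚ`:

* `WeierstrassCurve.bsdRHS_pos_holds`, discharging `WeierstrassCurve.bsdRHS_pos`: if `Ш(E/ℚ)` is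
  finite then `#Ш · Reg · Ω · ∏ c_p / (#E(ℚ)_tors)² > 0`, from the landed positivity of the five
  factors:
  `WeierstrassCurve.shaOrder_pos` (`Sha`: `#Ш ≥ 1` for finite `Ш`),
  `WeierstrassCurve.regulator_pos'` (`RegulatorProofs`: Silverman, *AEC*, Cor. VIII.9.7, the
  Néron–Tate height is a positive definite quadratic form on `E(ℚ) ⊗ ℝ`, after the Mordell–Weil
  theorem),
  `WeierstrassCurve.realPeriod_pos'` (`RealPeriod`, applied to `W ⊗ ℝ`: Cremona, *Algorithms*,
  §3.7),
  `WeierstrassCurve.tamagawaProduct_pos'` (`TamagawaFiniteIndexProofs`: each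
  `c_p = [E(ℚ_p) : E₀(ℚ_p)]` is a finite index, Silverman, *AEC*, Cor. VII.6.2, proved there by
  the compactness argument of *AEC* Exercise 7.6) and
  `WeierstrassCurve.torsionOrder_pos_holds` (`MordellWeilProofs`: *AEC* §VIII.7);
* the unpacked forms `WeierstrassCurve.bsdRHS_pos'` and `WeierstrassCurve.bsdRHS_ne_zero`.

As for `WeierstrassCurve.realPeriodRat_pos_holds` (`ComplexMultiplicationBurungaleFlachProofs`),
the named fact is a `def` over every `W : WeierstrassCurve ℚ` (the section instance
`[W.IsElliptic]` of `BSDInvariants.lean` does not enter a `def` whose body does not use it) and is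
discharged for elliptic `W`, the documented scope of the fact ("an elliptic curve over `ℚ`",
Silverman, *AEC*, Conj. C.16.5) and the only case in which its factors are the BSD invariants
(for a singular cubic `Reg` and `Ω` take junk values).

## References

* J. H. Silverman, *The Arithmetic of Elliptic Curves*, 2nd ed., GTM 106 (2009), Cor. VII.6.2
  (p. 177) and Exercise 7.6, Cor. VIII.9.7 (p. 218), Conj. C.16.5 (p. 392).
* J. E. Cremona, *Algorithms for Modular Elliptic Curves*, 2nd ed. (1997), §3.7.
* A. Wiles, *The Birch and Swinnerton-Dyer conjecture*, Clay Mathematics Institute (2006), §1,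
  formula (4).
-/

noncomputable section

open scoped Classical

namespace WeierstrassCurve

variable (W : WeierstrassCurve ℚ) [W.IsElliptic]

/-- **Discharge of the named fact `WeierstrassCurve.bsdRHS_pos`** (`BSDInvariants.lean`): for an
elliptic curve `E/ℚ` with `Ш(E/ℚ)` finite, the right-hand side
`#Ш(E/ℚ) · Reg(E/ℚ) · Ω(E) · ∏_p c_p / (#E(ℚ)_tors)²` of the Birch–Swinnerton-Dyer formula
(Silverman, *AEC*, Conj. C.16.5(b); Wiles, Clay BSD text (2006), §1, formula (4)) is a positive
real number, all five factors being positive: `#Ш ≥ 1` for finite `Ш` (`shaOrder_pos`), `Reg > 0`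
(`regulator_pos'`: Silverman, *AEC*, Cor. VIII.9.7, after the Mordell–Weil theorem), `Ω > 0`
(`realPeriod_pos'` on `W ⊗ ℝ`: Cremona, *Algorithms*, §3.7), `∏ c_p ≥ 1`
(`tamagawaProduct_pos'`: each `c_p = [E(ℚ_p) : E₀(ℚ_p)]` is a finite index, Silverman, *AEC*,
Cor. VII.6.2, by the compactness argument of *AEC* Exercise 7.6) and `#E(ℚ)_tors ≥ 1`
(`torsionOrder_pos_holds`: *AEC* §VIII.7). The fact is discharged for elliptic `W`, its
documented scope (see the module docstring).
[cite: SilvermanAEC2009, Conj. C.16.5 (PDF p. 392) with Cor. VII.6.2 (PDF p. 177) and Cor. VIII.9.7 (PDF p. 218)] -/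
theorem bsdRHS_pos_holds : W.bsdRHS_pos := by
  intro hsha
  haveI : (W.baseChange ℝ).IsElliptic := by
    rw [baseChange]; infer_instance
  have h₁ : (0 : ℝ) < W.shaOrder := Nat.cast_pos.mpr (W.shaOrder_pos hsha)
  have h₂ : (0 : ℝ) < W.regulator := W.regulator_pos'
  have h₃ : (0 : ℝ) < W.realPeriodRat := by
    rw [realPeriodRat_def]
    exact (W.baseChange ℝ).realPeriod_pos'
  have h₄ : (0 : ℝ) < W.tamagawaProduct := Nat.cast_pos.mpr W.tamagawaProduct_pos'
  have h₅ : (0 : ℝ) < W.torsionOrder := Nat.cast_pos.mpr W.torsionOrder_pos_holds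
  rw [bsdRHS_def]
  positivity

/-- `bsdRHS_pos_holds`, unpacked: for an elliptic curve over `ℚ` with finite `Ш`,
`0 < W.bsdRHS`. [cite: SilvermanAEC2009, Conj. C.16.5 (PDF p. 392) with Cor. VII.6.2 (PDF p. 177) and Cor. VIII.9.7 (PDF p. 218)] -/
theorem bsdRHS_pos' (h : W.ShaFinite) : 0 < W.bsdRHS :=
  W.bsdRHS_pos_holds h

/-- In particular the BSD right-hand side of an elliptic curve over `ℚ` with finite `Ш` is
non-zero (so LEAD, `BSDLeadingTermFormula`, forces `L^{(r)}(E,1) ≠ 0` at `r = r_an`).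
[cite: SilvermanAEC2009, Conj. C.16.5 (PDF p. 392) with Cor. VII.6.2 (PDF p. 177) and Cor. VIII.9.7 (PDF p. 218)] -/
theorem bsdRHS_ne_zero (h : W.ShaFinite) : W.bsdRHS ≠ 0 :=
  (W.bsdRHS_pos' h).ne'

end WeierstrassCurve

end
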